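import Mathlib
import Literature.NumberTheory.Sieve.HybridLargeSieve
import HarnessLib

/-!
# The hybrid large sieve for all characters to a fixed modulus

Topic `Literature/NumberTheory/Sieve`, sub-namespace `LargeSieve`. Everything here is PROVED.

The companion of the hybrid large sieve `hybridSieve_character` (`HybridLargeSieve.lean`, primitive
characters to all moduli `q ≤ Q`) for the family of ALL Dirichlet characters to ONE modulus `q`:
for `T ≥ 1`, a finite set `S` of positive integers and complex `b_n`,

  `∑_{χ mod q} ∫_{−T}^{T} |∑_{n ∈ S} b_n χ(n) n^{it}|² dt ≤ π² φ(q) ∑_{n ∈ S} ((π e^π/2) n/q + T)|b_n|²`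
  `≤ (π³e^π/2) ∑_{n ∈ S} (n + qT)|b_n|²`

(`hybridSieve_fixedModulus`, `hybridSieve_fixedModulus_le`, `…_cpow`). This is the log-free form of
the case `k = q`, `Q = 1` of Iwaniec–Kowalski, *Analytic Number Theory*, Theorem 9.12
(`∑_{χ ∈ ℋ(k,Q)} ∫_0^T |∑_{n ≤ N} a_n χ(n) n^{it}|² dt ≪ (N + kQ²T)‖a‖² 𝓛³`; the remark after (9.41)
there: "the factor `𝓛³` can be removed by the traditional method based on the large sieve … this
method also works for sequences supported in a short interval `M < n ≤ M + N`"), in Gallagher's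
weighted shape `∑ (qT + n)|a_n|²` (Gallagher 1970; Montgomery, *Topics*, Ch. 6).

Proof (Gallagher's method, as in `HybridLargeSieve.lean`): Gallagher's Lemma 1 reduces the
`t`-integral to logarithmic windows `e^{2πx} ≤ n ≤ e^{2π(x+δ)}`, `δ = 1/(2T)`, which are integer
intervals of length `N_x ≤ (e^{2πδ} − 1)n + 1`; on such a window ORTHOGONALITY of the characters
mod `q` (the tree's `sum_norm_sq_sum_char_mul`, Parseval on `(ℤ/qℤ)ˣ`) gives
`∑_{χ mod q} |∑_{n ∈ W} c_n χ(n)|² ≤ φ(q)(N_x/q + 1) ∑_{n ∈ W} |c_n|²` (`sum_char_norm_sq_finset_le`: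
each residue class meets an interval of length `N_x` in at most `N_x/q + 1` integers, and
Cauchy–Schwarz inside each class).

## References
* [IwaniecKowalski2004] Theorem 9.12 and the remark after (9.41); Thm 7.17.
* [Gallagher1970] Theorems 1–3; [Montgomery1971] Ch. 6.
-/

noncomputable section

open Finset Real Complex MeasureTheory
open scoped ComplexConjugate FourierTransform

namespace Literature.NumberTheory.Sieve.LargeSieve

open DirichletCharacter Literature.NumberTheory.Sieve.Gallagher

/-! ### Orthogonality on an interval -/

/-- Cauchy–Schwarz on a finite set: `|∑_{i ∈ W} c_i|² ≤ |W| ∑_{i ∈ W} |c_i|²`. [folklore] -/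
private theorem norm_sq_sum_le_card_mul' (W : Finset ℕ) (c : ℕ → ℂ) :
    ‖∑ i ∈ W, c i‖ ^ 2 ≤ (W.card : ℝ) * ∑ i ∈ W, ‖c i‖ ^ 2 := by
  have h1 : ‖∑ i ∈ W, c i‖ ≤ ∑ i ∈ W, ‖c i‖ := norm_sum_le _ _
  have h2 : (∑ i ∈ W, ‖c i‖) ^ 2 ≤ (W.card : ℝ) * ∑ i ∈ W, ‖c i‖ ^ 2 := by
    have h := Finset.sum_mul_sq_le_sq_mul_sq W (fun _ => (1 : ℝ)) (fun i => ‖c i‖)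
    simp only [one_mul, one_pow, sum_const, nsmul_eq_mul, mul_one] at h
    exact h
  exact (pow_le_pow_left₀ (norm_nonneg _) h1 2).trans h2

/-- A residue class mod `q` meets a set of integers in `(M₀, M₀ + N]` in at most `N/q + 1`
elements. [folklore] -/
private theorem card_filter_mod_le (q : ℕ) (W : Finset ℕ) (M₀ N b : ℕ)
    (hW : ∀ n ∈ W, M₀ < n ∧ n ≤ M₀ + N) :
    (W.filter (fun n => n % q = b)).card ≤ N / q + 1 := by
  have h : (W.filter (fun n => n % q = b)).card ≤ (range (N / q + 1)).card := by
    refine Finset.card_le_card_of_injOn (fun n => (n - (M₀ + 1)) / q) ?_ ?_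
    · intro n hn
      rw [mem_coe, mem_filter] at hn
      rw [mem_coe, mem_range]
      show (n - (M₀ + 1)) / q < N / q + 1
      have h0 := hW n hn.1
      have h2 : (n - (M₀ + 1)) / q ≤ N / q := Nat.div_le_div_right (by omega)
      omega
    · intro n hn n' hn' h
      rw [mem_coe, mem_filter] at hn hn'
      have h0 := hW n hn.1
      have h0' := hW n' hn'.1
      have e1 : n = (n - (M₀ + 1)) + (M₀ + 1) := by omega
      have e2 : n' = (n' - (M₀ + 1)) + (M₀ + 1) := by omega
      have hmod : Nat.ModEq q n n' := hn.2.trans hn'.2.symm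
      rw [e1, e2] at hmod
      have hmod' : (n - (M₀ + 1)) % q = (n' - (M₀ + 1)) % q := Nat.ModEq.add_right_cancel' _ hmod
      have d1 := Nat.div_add_mod (n - (M₀ + 1)) q
      have d2 := Nat.div_add_mod (n' - (M₀ + 1)) q
      have h' : (n - (M₀ + 1)) / q = (n' - (M₀ + 1)) / q := h
      rw [h', hmod'] at d1
      omega
  simpa using h

/-- **Orthogonality in mean square on an interval** (the "trivial" large sieve for one modulus;
Iwaniec–Kowalski (9.41) with `Q = 1`, remark): for `q ≥ 1` and coefficients `c_n` on a finite set
`W ⊆ (M₀, M₀ + N]`, `∑_{χ mod q} |∑_{n ∈ W} c_n χ(n)|² ≤ φ(q) (N/q + 1) ∑_{n ∈ W} |c_n|²`.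
[cite: IwaniecKowalski2004, Thm 9.12 (remark after (9.41))] -/
theorem sum_char_norm_sq_finset_le (q : ℕ) [NeZero q] (W : Finset ℕ) (M₀ N : ℕ)
    (hW : ∀ n ∈ W, M₀ < n ∧ n ≤ M₀ + N) (c : ℕ → ℂ) :
    ∑ χ : DirichletCharacter ℂ q, ‖∑ n ∈ W, c n * χ n‖ ^ 2 ≤
      (q.totient : ℝ) * ((N : ℝ) / q + 1) * ∑ n ∈ W, ‖c n‖ ^ 2 := by
  have hq : 0 < q := Nat.pos_of_ne_zero (NeZero.ne q)
  -- group by residues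
  set C : ℕ → ℂ := fun b => ∑ n ∈ W.filter (fun n => n % q = b), c n with hC
  have hmaps : ∀ n ∈ W, n % q ∈ range q := fun n _ => mem_range.2 (Nat.mod_lt n hq)
  have hgroup : ∀ χ : DirichletCharacter ℂ q,
      ∑ n ∈ W, c n * χ n = ∑ b ∈ range q, χ b * C b := by
    intro χ
    rw [← Finset.sum_fiberwise_of_maps_to hmaps]
    refine sum_congr rfl fun b _ => ?_
    rw [hC, mul_sum]
    refine sum_congr rfl fun n hn => ?_
    rw [mem_filter] at hn
    rw [← ZMod.natCast_mod n q, hn.2, mul_comm]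
  have horth := sum_norm_sq_sum_char_mul (q := q) C
  have hgroup2 : ∀ χ : DirichletCharacter ℂ q,
      ‖∑ n ∈ W, c n * χ n‖ ^ 2 = ‖∑ b ∈ range q, χ b * C b‖ ^ 2 := fun χ => by rw [hgroup]
  rw [Fintype.sum_congr _ _ hgroup2, horth]
  -- bound each class by Cauchy–Schwarz and the class count
  have hclass : ∀ b ∈ range q, ‖C b‖ ^ 2 ≤
      ((N : ℝ) / q + 1) * ∑ n ∈ W.filter (fun n => n % q = b), ‖c n‖ ^ 2 := by
    intro b _
    refine (norm_sq_sum_le_card_mul' _ c).trans (mul_le_mul_of_nonneg_right ?_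
      (sum_nonneg fun _ _ => by positivity))
    have h1 : (((W.filter (fun n => n % q = b)).card : ℕ) : ℝ) ≤ ((N / q + 1 : ℕ) : ℝ) := by
      exact_mod_cast card_filter_mod_le q W M₀ N b hW
    refine h1.trans ?_
    push_cast
    exact add_le_add (Nat.cast_div_le) le_rfl
  have hφ : (0 : ℝ) ≤ q.totient := Nat.cast_nonneg _
  calc (q.totient : ℝ) * ∑ b ∈ range q with b.Coprime q, ‖C b‖ ^ 2
      ≤ (q.totient : ℝ) * ∑ b ∈ range q, ‖C b‖ ^ 2 :=
        mul_le_mul_of_nonneg_left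
          (sum_le_sum_of_subset_of_nonneg (filter_subset _ _) fun _ _ _ => by positivity) hφ
    _ ≤ (q.totient : ℝ) * ∑ b ∈ range q,
          ((N : ℝ) / q + 1) * ∑ n ∈ W.filter (fun n => n % q = b), ‖c n‖ ^ 2 :=
        mul_le_mul_of_nonneg_left (sum_le_sum hclass) hφ
    _ = (q.totient : ℝ) * ((N : ℝ) / q + 1) * ∑ n ∈ W, ‖c n‖ ^ 2 := by
        rw [← mul_sum, Finset.sum_fiberwise_of_maps_to hmaps, mul_assoc]

/-! ### One logarithmic window -/

/-- **One window, one modulus**: for every real `x`, with `W_x = {n ∈ S : x ≤ ν_n ≤ x + δ}`,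
`∑_{χ mod q} |T ∑_{n ∈ W_x} b_n χ(n)|² ≤ ∑_{n ∈ S} |b_n|² T²φ(q)(((e^{2πδ} − 1)n + 1)/q + 1) 𝟙_{[ν_n−δ,ν_n]}(x)`.
[cite: IwaniecKowalski2004, Thm 9.12 (remark after (9.41))] -/
theorem window_bound_fixedModulus (q : ℕ) [NeZero q] (S : Finset ℕ) (hS : ∀ n ∈ S, 1 ≤ n)
    (b : ℕ → ℂ) {T δ : ℝ} (hδ : 0 < δ) (x : ℝ) :
    ∑ χ : DirichletCharacter ℂ q,
        ‖(T : ℂ) * ∑ n ∈ S.filter (fun n => x ≤ logFreq n ∧ logFreq n ≤ x + δ), b n * χ n‖ ^ 2 ≤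
      ∑ n ∈ S, ‖b n‖ ^ 2 *
        (T ^ 2 * (q.totient : ℝ) * (((Real.exp (2 * π * δ) - 1) * n + 1) / q + 1)) *
          (Set.Icc (logFreq n - δ) (logFreq n)).indicator (fun _ => (1 : ℝ)) x := by
  set Wx : Finset ℕ := S.filter (fun n => x ≤ logFreq n ∧ logFreq n ≤ x + δ) with hWx
  set M₀ : ℕ := ⌈Real.exp (2 * π * x)⌉₊ - 1 with hM₀
  set N : ℕ := ⌊Real.exp (2 * π * (x + δ))⌋₊ + 1 - ⌈Real.exp (2 * π * x)⌉₊ with hN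
  have hWin : ∀ n ∈ Wx, M₀ < n ∧ n ≤ M₀ + N := by
    intro n hn
    rw [hWx, mem_filter] at hn
    exact mem_logWindow_bounds (hS n hn.1) hn.2
  have hq0 : (0 : ℝ) < q := by exact_mod_cast Nat.pos_of_ne_zero (NeZero.ne q)
  -- orthogonality on the window, coefficients `T b_n`
  have hls := sum_char_norm_sq_finset_le q Wx M₀ N hWin (fun n => (T : ℂ) * b n)
  have hmul : ∀ χ : DirichletCharacter ℂ q,
      (T : ℂ) * ∑ n ∈ Wx, b n * χ n = ∑ n ∈ Wx, (T : ℂ) * b n * χ n := by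
    intro χ; rw [mul_sum]; exact sum_congr rfl fun n _ => by ring
  simp only [hmul]
  refine hls.trans ?_
  have hNle : (N : ℝ) ≤ (Real.exp (2 * π * δ) - 1) * Real.exp (2 * π * x) + 1 :=
    logWindow_length_le x hδ
  have hexpδ : 0 ≤ Real.exp (2 * π * δ) - 1 := by
    linarith [Real.exp_le_exp.2 (show (0:ℝ) ≤ 2 * π * δ by positivity), Real.exp_zero]
  have hφ : (0 : ℝ) ≤ q.totient := Nat.cast_nonneg _
  -- termwise comparison
  have hterm : ∀ n ∈ Wx, (q.totient : ℝ) * ((N : ℝ) / q + 1) * ‖(T : ℂ) * b n‖ ^ 2 ≤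
      ‖b n‖ ^ 2 *
        (T ^ 2 * (q.totient : ℝ) * (((Real.exp (2 * π * δ) - 1) * n + 1) / q + 1)) := by
    intro n hn
    have hn' := hn
    rw [hWx, mem_filter] at hn'
    obtain ⟨h1, -⟩ := exp_le_of_logFreq_window (hS n hn'.1) hn'.2
    have hN2 : (N : ℝ) ≤ (Real.exp (2 * π * δ) - 1) * n + 1 := by
      nlinarith [mul_le_mul_of_nonneg_left h1 hexpδ]
    have hN3 : (N : ℝ) / q + 1 ≤ ((Real.exp (2 * π * δ) - 1) * n + 1) / q + 1 :=
      add_le_add (div_le_div_of_nonneg_right hN2 hq0.le) le_rfl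
    rw [norm_mul, Complex.norm_real, Real.norm_eq_abs, mul_pow, sq_abs]
    have hb : 0 ≤ T ^ 2 * ‖b n‖ ^ 2 := by positivity
    calc (q.totient : ℝ) * ((N : ℝ) / q + 1) * (T ^ 2 * ‖b n‖ ^ 2)
        ≤ (q.totient : ℝ) * (((Real.exp (2 * π * δ) - 1) * n + 1) / q + 1) * (T ^ 2 * ‖b n‖ ^ 2) :=
          mul_le_mul_of_nonneg_right (mul_le_mul_of_nonneg_left hN3 hφ) hb
      _ = _ := by ring
  rw [mul_sum]
  refine (sum_le_sum hterm).trans ?_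
  rw [hWx, sum_filter]
  refine sum_le_sum fun n _ => ?_
  by_cases hw : x ≤ logFreq n ∧ logFreq n ≤ x + δ
  · rw [if_pos hw, Set.indicator_of_mem (by rw [Set.mem_Icc]; constructor <;> linarith [hw.1, hw.2]),
      mul_one]
  · rw [if_neg hw, Set.indicator_of_notMem (by
      rw [Set.mem_Icc]; intro h'; exact hw ⟨h'.2, by linarith [h'.1]⟩), mul_zero]

/-! ### The hybrid sieve for one modulus -/

/-- **The hybrid large sieve for all characters to a fixed modulus** (log-free form of the case
`k = q`, `Q = 1` of Iwaniec–Kowalski Thm 9.12, Gallagher's weights): for `q ≥ 1`, `T ≥ 1`, a finite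
set `S` of positive integers and complex `b_n`,
`∑_{χ mod q} ∫_{−T}^{T} |∑_{n ∈ S} b_n χ(n) e(ν_n t)|² dt ≤ π² φ(q) ∑_{n ∈ S} ((π e^π/2) n/q + T)|b_n|²`.
[cite: IwaniecKowalski2004, Thm 9.12 (remark after (9.41))] -/
theorem hybridSieve_fixedModulus (q : ℕ) [NeZero q] {T : ℝ} (hT : 1 ≤ T) (S : Finset ℕ)
    (hS : ∀ n ∈ S, 1 ≤ n) (b : ℕ → ℂ) :
    ∑ χ : DirichletCharacter ℂ q,
        ∫ t in (-T)..T, ‖∑ n ∈ S, b n * χ n * (𝐞 (logFreq n * t) : ℂ)‖ ^ 2 ≤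
      π ^ 2 * (q.totient : ℝ) * ∑ n ∈ S, (π * Real.exp π / 2 * n / q + T) * ‖b n‖ ^ 2 := by
  have hT0 : 0 < T := by linarith
  have hq0 : (0 : ℝ) < q := by exact_mod_cast Nat.pos_of_ne_zero (NeZero.ne q)
  have hq1 : (1 : ℝ) ≤ q := by exact_mod_cast Nat.pos_of_ne_zero (NeZero.ne q)
  set δ : ℝ := (2 * T)⁻¹ with hδ
  have hδ0 : 0 < δ := by rw [hδ]; positivity
  set K : ℕ → ℝ := fun n =>
    T ^ 2 * (q.totient : ℝ) * (((Real.exp (2 * π * δ) - 1) * n + 1) / q + 1) with hK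
  -- Step 1: Gallagher's lemma for each character
  have hG : ∀ χ : DirichletCharacter ℂ q,
      ∫ t in (-T)..T, ‖∑ n ∈ S, b n * χ n * (𝐞 (logFreq n * t) : ℂ)‖ ^ 2 ≤
        π ^ 2 * ∫ x : ℝ, ‖(T : ℂ) * ∑ n ∈ S.filter (fun n => x ≤ logFreq n ∧ logFreq n ≤ x + δ),
          b n * χ n‖ ^ 2 := by
    intro χ
    have h := gallagher_lemma_general S logFreq (fun n => b n * χ n) hT0
    rw [← hδ] at h
    exact h
  -- Step 2: sum over `χ` and move the sum inside the integral
  have hint : ∀ χ : DirichletCharacter ℂ q, Integrable fun x : ℝ =>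
      ‖(T : ℂ) * ∑ n ∈ S.filter (fun n => x ≤ logFreq n ∧ logFreq n ≤ x + δ), b n * χ n‖ ^ 2 :=
    fun χ => integrable_normSq_windowSum S logFreq (fun n => b n * χ n) T δ
  have hstep2 : ∑ χ : DirichletCharacter ℂ q,
      ∫ t in (-T)..T, ‖∑ n ∈ S, b n * χ n * (𝐞 (logFreq n * t) : ℂ)‖ ^ 2 ≤
      π ^ 2 * ∫ x : ℝ, ∑ χ : DirichletCharacter ℂ q,
        ‖(T : ℂ) * ∑ n ∈ S.filter (fun n => x ≤ logFreq n ∧ logFreq n ≤ x + δ), b n * χ n‖ ^ 2 := by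
    rw [integral_finsetSum _ fun χ _ => hint χ, mul_sum]
    exact sum_le_sum fun χ _ => hG χ
  -- Step 3: the pointwise bound integrated
  have hRint : Integrable fun x : ℝ => ∑ n ∈ S, ‖b n‖ ^ 2 * K n *
      (Set.Icc (logFreq n - δ) (logFreq n)).indicator (fun _ => (1 : ℝ)) x := by
    refine integrable_finsetSum _ fun n _ => ?_
    refine Integrable.const_mul ?_ _
    rw [integrable_indicator_iff measurableSet_Icc]
    exact integrableOn_const (by exact measure_Icc_lt_top.ne)
  have hstep3 : ∫ x : ℝ, ∑ χ : DirichletCharacter ℂ q,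
        ‖(T : ℂ) * ∑ n ∈ S.filter (fun n => x ≤ logFreq n ∧ logFreq n ≤ x + δ), b n * χ n‖ ^ 2 ≤
      ∫ x : ℝ, ∑ n ∈ S, ‖b n‖ ^ 2 * K n *
        (Set.Icc (logFreq n - δ) (logFreq n)).indicator (fun _ => (1 : ℝ)) x := by
    refine integral_mono (integrable_finsetSum _ fun χ _ => hint χ) hRint fun x => ?_
    exact window_bound_fixedModulus q S hS b hδ0 x
  -- Step 4: evaluate the right-hand integral
  have hstep4 : ∫ x : ℝ, ∑ n ∈ S, ‖b n‖ ^ 2 * K n *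
      (Set.Icc (logFreq n - δ) (logFreq n)).indicator (fun _ => (1 : ℝ)) x =
      ∑ n ∈ S, ‖b n‖ ^ 2 * K n * δ := by
    rw [integral_finsetSum _ fun n _ => ?_]
    · exact sum_congr rfl fun n _ => integral_const_mul_indicator_Icc _ _ hδ0.le
    · refine Integrable.const_mul ?_ _
      rw [integrable_indicator_iff measurableSet_Icc]
      exact integrableOn_const (by exact measure_Icc_lt_top.ne)
  -- Step 5: the arithmetic `K_n δ ≤ φ(q)((π e^π/2) n/q + T)`
  have hexpδ : (Real.exp (2 * π * δ) - 1) * T ≤ π * Real.exp π := by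
    rw [hδ]; exact exp_two_pi_delta_sub_one_mul_le hT
  have hφ : (0 : ℝ) ≤ q.totient := Nat.cast_nonneg _
  have hKδ : ∀ n ∈ S, ‖b n‖ ^ 2 * K n * δ ≤
      (q.totient : ℝ) * ((π * Real.exp π / 2 * n / q + T) * ‖b n‖ ^ 2) := by
    intro n _
    have hn0 : (0 : ℝ) ≤ n := Nat.cast_nonneg n
    have hTδ : T ^ 2 * δ = T / 2 := by
      rw [hδ]; field_simp
    have hmain : T ^ 2 * (((Real.exp (2 * π * δ) - 1) * n + 1) / q + 1) * δ ≤
        π * Real.exp π / 2 * n / q + T := by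
      have hA : (T ^ 2 * δ) * ((Real.exp (2 * π * δ) - 1) * n) ≤ π * Real.exp π / 2 * n := by
        rw [hTδ]
        have := mul_le_mul_of_nonneg_right hexpδ hn0
        nlinarith
      have hA' : (T ^ 2 * δ) * ((Real.exp (2 * π * δ) - 1) * n) / q ≤ π * Real.exp π / 2 * n / q :=
        div_le_div_of_nonneg_right hA hq0.le
      have hB : (T ^ 2 * δ) / q + T ^ 2 * δ ≤ T := by
        rw [hTδ]
        have : T / 2 / q ≤ T / 2 := div_le_self (by positivity) hq1
        linarith
      calc T ^ 2 * (((Real.exp (2 * π * δ) - 1) * n + 1) / q + 1) * δ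
          = (T ^ 2 * δ) * ((Real.exp (2 * π * δ) - 1) * n) / q + ((T ^ 2 * δ) / q + T ^ 2 * δ) := by
            field_simp; ring
        _ ≤ π * Real.exp π / 2 * n / q + T := add_le_add hA' hB
    have hb : 0 ≤ ‖b n‖ ^ 2 := by positivity
    calc ‖b n‖ ^ 2 * K n * δ
        = (q.totient : ℝ) * ((T ^ 2 * (((Real.exp (2 * π * δ) - 1) * n + 1) / q + 1) * δ) *
            ‖b n‖ ^ 2) := by rw [hK]; ring
      _ ≤ (q.totient : ℝ) * ((π * Real.exp π / 2 * n / q + T) * ‖b n‖ ^ 2) :=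
          mul_le_mul_of_nonneg_left (mul_le_mul_of_nonneg_right hmain hb) hφ
  -- assemble
  calc _ ≤ π ^ 2 * ∫ x : ℝ, ∑ χ : DirichletCharacter ℂ q,
        ‖(T : ℂ) * ∑ n ∈ S.filter (fun n => x ≤ logFreq n ∧ logFreq n ≤ x + δ), b n * χ n‖ ^ 2 :=
        hstep2
    _ ≤ π ^ 2 * ∑ n ∈ S, ‖b n‖ ^ 2 * K n * δ := by
        rw [← hstep4]; exact mul_le_mul_of_nonneg_left hstep3 (by positivity)
    _ ≤ π ^ 2 * ∑ n ∈ S, (q.totient : ℝ) * ((π * Real.exp π / 2 * n / q + T) * ‖b n‖ ^ 2) :=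
        mul_le_mul_of_nonneg_left (sum_le_sum hKδ) (by positivity)
    _ = _ := by rw [← mul_sum, mul_assoc]

/-- **The hybrid large sieve for one modulus, form `≪ ∑ (n + qT)|a_n|²`**: for `q ≥ 1`, `T ≥ 1`,
`∑_{χ mod q} ∫_{−T}^{T} |∑_{n ∈ S} b_n χ(n) e(ν_n t)|² dt ≤ (π³e^π/2) ∑_{n ∈ S} (n + qT)|b_n|²`
(`φ(q) ≤ q`). [cite: IwaniecKowalski2004, Thm 9.12 (remark after (9.41))] -/
theorem hybridSieve_fixedModulus_le (q : ℕ) [NeZero q] {T : ℝ} (hT : 1 ≤ T) (S : Finset ℕ)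
    (hS : ∀ n ∈ S, 1 ≤ n) (b : ℕ → ℂ) :
    ∑ χ : DirichletCharacter ℂ q,
        ∫ t in (-T)..T, ‖∑ n ∈ S, b n * χ n * (𝐞 (logFreq n * t) : ℂ)‖ ^ 2 ≤
      (π ^ 3 * Real.exp π / 2) * ∑ n ∈ S, ((n : ℝ) + q * T) * ‖b n‖ ^ 2 := by
  refine (hybridSieve_fixedModulus q hT S hS b).trans ?_
  have hT0 : 0 ≤ T := by linarith
  have hq0 : (0 : ℝ) < q := by exact_mod_cast Nat.pos_of_ne_zero (NeZero.ne q)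
  have hφq : (q.totient : ℝ) ≤ q := by exact_mod_cast Nat.totient_le q
  have hφ : (0 : ℝ) ≤ q.totient := Nat.cast_nonneg _
  have hc : (1 : ℝ) ≤ π * Real.exp π / 2 := by
    nlinarith [Real.exp_pos π, Real.pi_gt_three, Real.add_one_le_exp π]
  have hterm : ∀ n ∈ S, (q.totient : ℝ) * ((π * Real.exp π / 2 * n / q + T) * ‖b n‖ ^ 2) ≤
      (π * Real.exp π / 2) * (((n : ℝ) + q * T) * ‖b n‖ ^ 2) := by
    intro n _
    have hb : 0 ≤ ‖b n‖ ^ 2 := by positivity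
    have hn0 : (0 : ℝ) ≤ n := Nat.cast_nonneg n
    have h1 : (q.totient : ℝ) * (π * Real.exp π / 2 * n / q) ≤ π * Real.exp π / 2 * n := by
      calc (q.totient : ℝ) * (π * Real.exp π / 2 * n / q) ≤ q * (π * Real.exp π / 2 * n / q) :=
            mul_le_mul_of_nonneg_right hφq (by positivity)
        _ = π * Real.exp π / 2 * n := by field_simp
    have h2 : (q.totient : ℝ) * T ≤ (π * Real.exp π / 2) * (q * T) := by
      calc (q.totient : ℝ) * T ≤ q * T := mul_le_mul_of_nonneg_right hφq hT0
        _ ≤ (π * Real.exp π / 2) * (q * T) := le_mul_of_one_le_left (by positivity) hc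
    calc (q.totient : ℝ) * ((π * Real.exp π / 2 * n / q + T) * ‖b n‖ ^ 2)
        = ((q.totient : ℝ) * (π * Real.exp π / 2 * n / q) + (q.totient : ℝ) * T) * ‖b n‖ ^ 2 := by
          ring
      _ ≤ (π * Real.exp π / 2 * n + (π * Real.exp π / 2) * (q * T)) * ‖b n‖ ^ 2 :=
          mul_le_mul_of_nonneg_right (add_le_add h1 h2) hb
      _ = _ := by ring
  calc π ^ 2 * (q.totient : ℝ) * ∑ n ∈ S, (π * Real.exp π / 2 * n / q + T) * ‖b n‖ ^ 2
      = π ^ 2 * ∑ n ∈ S, (q.totient : ℝ) * ((π * Real.exp π / 2 * n / q + T) * ‖b n‖ ^ 2) := by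
        rw [mul_sum, mul_sum]
        exact sum_congr rfl fun n _ => by ring
    _ ≤ π ^ 2 * ∑ n ∈ S, (π * Real.exp π / 2) * (((n : ℝ) + q * T) * ‖b n‖ ^ 2) :=
        mul_le_mul_of_nonneg_left (sum_le_sum hterm) (by positivity)
    _ = (π ^ 3 * Real.exp π / 2) * ∑ n ∈ S, ((n : ℝ) + q * T) * ‖b n‖ ^ 2 := by
        rw [← mul_sum]; ring

/-- **The hybrid large sieve for one modulus in the notation `n^{it}`**: for `q ≥ 1`, `T ≥ 1`,
`∑_{χ mod q} ∫_{−T}^{T} |∑_{n ∈ S} b_n χ(n) n^{it}|² dt ≤ (π³e^π/2) ∑_{n ∈ S} (n + qT)|b_n|²`.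
[cite: IwaniecKowalski2004, Thm 9.12 (remark after (9.41))] -/
theorem hybridSieve_fixedModulus_cpow (q : ℕ) [NeZero q] {T : ℝ} (hT : 1 ≤ T) (S : Finset ℕ)
    (hS : ∀ n ∈ S, 1 ≤ n) (b : ℕ → ℂ) :
    ∑ χ : DirichletCharacter ℂ q,
        ∫ t in (-T)..T, ‖∑ n ∈ S, b n * χ n * (n : ℂ) ^ ((t : ℂ) * I)‖ ^ 2 ≤
      (π ^ 3 * Real.exp π / 2) * ∑ n ∈ S, ((n : ℝ) + q * T) * ‖b n‖ ^ 2 := by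
  have h := hybridSieve_fixedModulus_le q hT S hS b
  have heq : ∀ (χ : DirichletCharacter ℂ q) (t : ℝ),
      ∑ n ∈ S, b n * χ n * (n : ℂ) ^ ((t : ℂ) * I) =
        ∑ n ∈ S, b n * χ n * (𝐞 (logFreq n * t) : ℂ) := fun χ t =>
    sum_congr rfl fun n hn => by rw [natCast_cpow_mul_I n (hS n hn) t]
  simp only [heq]
  exact h

end Literature.NumberTheory.Sieve.LargeSieve
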